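import Mathlib.Geometry.Manifold.ContMDiff.NormedSpace
import Mathlib.Geometry.Manifold.MFDeriv.SpecificFunctions
import Mathlib.Topology.Algebra.Module.FiniteDimension
import Literature.Geometry.Kaehler.Kaehler
import Literature.Geometry.Kaehler.AnalyticSetSingularLocus
import Literature.Geometry.Kaehler.PluriharmonicLog
import Literature.NumberTheory.Transcendental.ComplexFormsPullback
import HarnessLib

/-!
# Nearly holomorphic cycle supports (defect of a `C¹` cycle from being a holomorphic chain)

Topic `Literature/Geometry/Kaehler`. Setting of `Kaehler.lean`: a complex manifold `M` charted on
a complex normed space `E`, regarded as a real manifold with the same charts (`𝓘(ℝ, E)`,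
`NormedSpace.complexToReal`), a Riemannian metric `g` on the real tangent bundle
(`Bundle.RiemannianMetric`, pointwise data only), and the complex structure
`J = Literature.Geometry.Kaehler.tangentJ E x` on `T_x M = E`.

* `Literature.Geometry.Kaehler.HasJDefectLE g x t V` — a subset `V ⊆ T_x M` (in practice a real
  linear subspace) is *nearly complex with defect `≤ t`*: every `v ∈ V` has some `w ∈ V` with
  `g(Jv - w, Jv - w) ≤ t² · g(v, v)`, i.e. `dist_g(Jv, V) ≤ |t| · |v|_g`. Defect `0` means
  `J V ⊆ V`, a complex subspace (`hasJDefectLE_zero_iff`). For a real `2`-plane this is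
  `|sin α| ≤ |t|`, `α` the Kähler angle of Chern–Wolfson (`ω|_V = cos α · dvol_V`,
  [HanLi2005, §1]: "holomorphic curve if `cos α ≡ 1`"); for the tangent space
  `T Z = ker (∂s + ∂̄s)` of the zero set of a section, `T Z` is complex iff `∂̄s = 0` there and is
  symplectic as soon as `|∂̄s| < |∂s|` (Donaldson's criterion, [McDuffSalamon2017, Lemma 7.4.2];
  [Donaldson1996, §1]).
* `Literature.Geometry.Kaehler.IsNearlyHolomorphicRegularPoint g p t S x` — near `x`, `S` is a real
  `C¹` submanifold of real codimension `2p` presented as a regular level set (an open `U ∋ x` and a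
  `C¹` map `f : M → ℝ^{2p}` on `U` with `S ∩ U = U ∩ f⁻¹(0)` and `df_x` onto), whose tangent space
  `ker df_x` has `J`-defect `≤ t`. This is the real-`C¹` analogue, with a defect, of
  `Literature.Geometry.Kaehler.IsRegularPointOfCodim` (holomorphic `f : M → ℂᵖ`), and every regular
  point of complex codimension `p` of any set is such a point with defect `0`
  (`IsRegularPointOfCodim.isNearlyHolomorphicRegularPoint`: realify the holomorphic equations; the
  kernel of a `ℂ`-linear map is `J`-stable).
* `Literature.Geometry.Kaehler.IsNearlyHolomorphicCycleSupport g p t S Sg` — the notion requested by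
  the Hodge summit's route *HolomorphicityRate* (its items `RateGap`, `SuperThresholdRigidity`,
  `NonHodgeRateAtMostOne`, `ThresholdForcesHodgeType`, `UniversalRateOne` inline it verbatim): a
  **nearly holomorphic cycle support of (complex) codimension `p` and defect `≤ t`, with bad set
  `Sg`**: `S ⊇ Sg` both closed, `S ∖ Sg` connected and consisting of nearly holomorphic regular
  points of codimension `p` and defect `≤ t`, `S` analytic near each point of `Sg`, and `Sg`
  contained in a (closed) analytic subset all of whose regular points have complex codimension
  `≥ p + 1`. Model cases: an irreducible analytic subset of pure codimension `p` with `t = 0` and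
  `Sg` its singular locus (`HasPureCodim.isNearlyHolomorphicCycleSupport`, given connectedness of
  the regular locus and the smallness of the singular locus as hypotheses); the zero locus of an
  asymptotically holomorphic, uniformly transverse section with `Sg = ∅`
  (`isNearlyHolomorphicCycleSupport_empty_iff`), whose defect is `O(k^{-1/2})`
  ([Donaldson1996, Thm. 5]; [Auroux1997]).

## API

* unfolding: `isNearlyHolomorphicCycleSupport_iff` (fully inlined, `Iff.rfl`) and, for a smooth
  metric `g : Bundle.ContMDiffRiemannianMetric …` as quantified in the route,
  `isNearlyHolomorphicCycleSupport_toRiemannianMetric_iff`, whose right-hand side is the route's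
  inline text verbatim (so each item is restated as
  `IsNearlyHolomorphicCycleSupport g.toRiemannianMetric p t S Sg ∧ …`);
* monotonicity in the defect (`HasJDefectLE.mono`, `IsNearlyHolomorphicRegularPoint.mono`,
  `IsNearlyHolomorphicCycleSupport.mono`: `|t| ≤ |t'|`);
* comparison of metrics (`….of_inner_le`: if `c₁ g ≤ g' ≤ c₂ g` pointwise, defect `≤ t` for `g`
  gives defect `≤ t'` for `g'` whenever `c₂ t² ≤ c₁ t'²`), the pointwise half of "two metrics on a
  compact manifold have comparable defects";
* defect `0` ⟺ `J`-stable (`hasJDefectLE_zero_iff`), `J`-stable ⟹ every defect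
  (`HasJDefectLE.of_forall_tangentJ_mem`);
* `Sg = ∅` (`isNearlyHolomorphicCycleSupport_empty_iff`), projections (`.isClosed`, `.subset`, …);
* holomorphic ⟹ nearly holomorphic of defect `0`:
  `IsRegularPointOfCodim.isNearlyHolomorphicRegularPoint` (the holomorphic equations are real `C^∞`
  by `contMDiffOn_real_of_mdifferentiableOn_complex` of `PluriharmonicLog.lean` — Osgood — and
  their real differential is the `ℂ`-linear complex one,
  `Literature.NumberTheory.Transcendental.hasMFDerivAt_real_of_complex`),
  `HasPureCodim.isNearlyHolomorphicRegularPoint`, `HasPureCodim.isNearlyHolomorphicCycleSupport`.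

## What is NOT here

* The converse regularity statement "defect `0` on `S ∖ Sg` and `Sg = sing S` ⟹ `S` is analytic of
  pure codimension `p`" (a real `C¹` submanifold with `J`-stable tangent spaces is a complex
  submanifold: locally a graph with `ℂ`-linear differential, hence holomorphic by Cauchy–Riemann)
  is not formalised; nor are invariance under biholomorphisms and the existence of comparison
  constants `c₁, c₂` for two continuous metrics on a compact `M` (only the pointwise comparison
  `of_inner_le` is). No named facts are introduced.
* `t` is not required to be nonnegative (only `t²` enters; `mono` is stated with `|t| ≤ |t'|`).

## References

* S. K. Donaldson, *Symplectic submanifolds and almost-complex geometry*, J. Differential Geom. 44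
  (1996), §1 and Thm. 5 [Donaldson1996] (read through [McDuffSalamon2017, §7.4]).
* D. McDuff, D. Salamon, *Introduction to Symplectic Topology*, 3rd ed. (2017), Thm. 7.4.1,
  Lemma 7.4.2 (`|∂̄s| < |∂s|` on the zero set ⟹ symplectic; `T₀Z = ker(Σ aⱼζⱼ + Σ bⱼζ̄ⱼ)`)
  [McDuffSalamon2017].
* X. Han, J. Li, *The mean curvature flow approach to the symplectic isotopy problem*, IMRN 2005:26,
  §1 (Kähler angle, after Chern–Wolfson 1983) [HanLi2005].
* D. Auroux, *Asymptotically holomorphic families of symplectic submanifolds*, GAFA 7 (1997)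
  [Auroux1997].
* E. M. Chirka, *Complex Analytic Sets* (1989), §2.3 (regular and singular points) [Chirka1989].
-/

noncomputable section

open scoped Manifold ContDiff Topology
open Set Bundle

namespace Literature.Geometry.Kaehler

variable {E : Type*} [NormedAddCommGroup E] [NormedSpace ℂ E]
  {M : Type*} [TopologicalSpace M] [ChartedSpace E M]

/-! ### Definitions -/

section Defs

/-- `HasJDefectLE g x t V`: the subset `V ⊆ T_x M` (a real linear subspace in every use) is
*nearly complex with defect at most `t`* for the metric `g`: for every `v ∈ V` there is `w ∈ V`
with `g(Jv - w, Jv - w) ≤ t² g(v, v)` (`J = tangentJ E x`), i.e. `Jv` lies within `g`-distance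
`|t| |v|_g` of `V`. Defect `0` says `J V ⊆ V` (`hasJDefectLE_zero_iff`), i.e. `V` is a complex
subspace; for an oriented real `2`-plane the optimal `t` is `|sin α|`, `α` the Kähler angle
(`ω|_V = cos α dvol_V`, Chern–Wolfson; Han–Li: "`Σ` is a holomorphic curve if `cos α ≡ 1`"). The
tangent space `ker(∂s + ∂̄s)` of the zero set of a section is complex iff `∂̄s = 0` and symplectic
if `|∂̄s| < |∂s|` (Donaldson; McDuff–Salamon Lemma 7.4.2). A definition (the quantity bounded is
classical), packaged for `IsNearlyHolomorphicCycleSupport`.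
[cite: HanLi2005, §1] [cite: McDuffSalamon2017, Lemma 7.4.2] -/
def HasJDefectLE (g : RiemannianMetric (fun x : M ↦ TangentSpace 𝓘(ℝ, E) x)) (x : M) (t : ℝ)
    (V : Set (TangentSpace 𝓘(ℝ, E) x)) : Prop :=
  ∀ v ∈ V, ∃ w ∈ V,
    g.inner x (tangentJ E x v - w) (tangentJ E x v - w) ≤ t ^ 2 * g.inner x v v

/-- `IsNearlyHolomorphicRegularPoint g p t S x`: near `x`, the set `S ⊆ M` is a real `C¹`
submanifold of real codimension `2p` given as a regular level set — there are an open `U ∋ x` and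
`f : M → ℝ^{2p}`, `C¹` on `U` (`ContMDiffOn 𝓘(ℝ, E) 𝓘(ℝ, ℝ^{2p}) 1 f U`), with
`S ∩ U = U ∩ f⁻¹(0)` and `df_x = mfderiv f x` surjective — whose tangent space `ker df_x` at `x`
is nearly complex with defect `≤ t` (`HasJDefectLE`). The real-`C¹` counterpart, with a defect,
of `IsRegularPointOfCodim 𝓘(ℂ, E) S p x` (holomorphic equations `M → ℂᵖ`); every regular point of
complex codimension `p` is such a point with defect `0`
(`IsRegularPointOfCodim.isNearlyHolomorphicRegularPoint`). As there, `x ∈ S` is not part of the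
predicate. Zero sets of transverse sections with `|∂̄s| < |∂s|`: McDuff–Salamon Lemma 7.4.2
(after Donaldson 1996). [cite: McDuffSalamon2017, Lemma 7.4.2] -/
def IsNearlyHolomorphicRegularPoint (g : RiemannianMetric (fun x : M ↦ TangentSpace 𝓘(ℝ, E) x))
    (p : ℕ) (t : ℝ) (S : Set M) (x : M) : Prop :=
  ∃ U : Set M, IsOpen U ∧ x ∈ U ∧ ∃ f : M → (Fin (2 * p) → ℝ),
    ContMDiffOn 𝓘(ℝ, E) 𝓘(ℝ, Fin (2 * p) → ℝ) 1 f U ∧ S ∩ U = U ∩ f ⁻¹' {0} ∧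
      Function.Surjective (mfderiv 𝓘(ℝ, E) 𝓘(ℝ, Fin (2 * p) → ℝ) f x) ∧
        HasJDefectLE g x t {v | mfderiv 𝓘(ℝ, E) 𝓘(ℝ, Fin (2 * p) → ℝ) f x v = 0}

/-- `IsNearlyHolomorphicCycleSupport g p t S Sg`: **`S` is a nearly holomorphic cycle support of
complex codimension `p` and defect `≤ t`, with bad set `Sg`** — `S` and `Sg` are closed, `Sg ⊆ S`,
the good part `S ∖ Sg` is connected and every point of it is a nearly holomorphic regular point
of `S` of codimension `p` and defect `≤ t` (`IsNearlyHolomorphicRegularPoint`: local real `C¹`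
submersion charts `f : M → ℝ^{2p}` whose tangent planes `V` satisfy
`∀ v ∈ V, ∃ w ∈ V, g(Jv - w, Jv - w) ≤ t² g(v, v)`), `S` is analytic near each point of `Sg`
(`IsAnalyticSetAt 𝓘(ℂ, E) S x`), and `Sg` lies in a closed analytic subset `T` all of whose regular
points have complex codimension `≥ p + 1`. This is verbatim the representative predicate inlined
by the items of route `HolomorphicityRate` of the Hodge summit
(`isNearlyHolomorphicCycleSupport_toRiemannianMetric_iff`). Model cases: irreducible analytic
subsets of pure codimension `p` (`t = 0`, `Sg = sing S`; Chirka §2.3 for `reg`/`sng`;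
`HasPureCodim.isNearlyHolomorphicCycleSupport`) and zero loci of asymptotically holomorphic
transverse sections (`Sg = ∅`, McDuff–Salamon Thm. 7.4.1 / Lemma 7.4.2 after Donaldson).
[cite: McDuffSalamon2017, Thm. 7.4.1 and Lemma 7.4.2] [cite: Chirka1989, §2.3] -/
def IsNearlyHolomorphicCycleSupport (g : RiemannianMetric (fun x : M ↦ TangentSpace 𝓘(ℝ, E) x))
    (p : ℕ) (t : ℝ) (S Sg : Set M) : Prop :=
  IsClosed S ∧ IsClosed Sg ∧ Sg ⊆ S ∧ IsConnected (S \ Sg) ∧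
    (∀ x ∈ Sg, IsAnalyticSetAt 𝓘(ℂ, E) S x) ∧
    (∃ T : Set M, Sg ⊆ T ∧ (IsAnalyticSet 𝓘(ℂ, E) T ∧
      ∀ x ∈ regularLocus 𝓘(ℂ, E) T, ∀ q : ℕ, IsRegularPointOfCodim 𝓘(ℂ, E) T q x → p + 1 ≤ q)) ∧
    ∀ x ∈ S \ Sg, IsNearlyHolomorphicRegularPoint g p t S x

end Defs

/-! ### Unfolding -/

section Unfold

variable {g : RiemannianMetric (fun x : M ↦ TangentSpace 𝓘(ℝ, E) x)} {p : ℕ} {t : ℝ}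
  {S Sg : Set M} {x : M}

/-- Unfolding of `HasJDefectLE`. [folklore] -/
theorem hasJDefectLE_iff {V : Set (TangentSpace 𝓘(ℝ, E) x)} :
    HasJDefectLE g x t V ↔ ∀ v ∈ V, ∃ w ∈ V,
      g.inner x (tangentJ E x v - w) (tangentJ E x v - w) ≤ t ^ 2 * g.inner x v v :=
  Iff.rfl

/-- Unfolding of `IsNearlyHolomorphicRegularPoint`, with the defect condition inlined.
[folklore] -/
theorem isNearlyHolomorphicRegularPoint_iff :
    IsNearlyHolomorphicRegularPoint g p t S x ↔
      ∃ U : Set M, IsOpen U ∧ x ∈ U ∧ ∃ f : M → (Fin (2 * p) → ℝ),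
        ContMDiffOn 𝓘(ℝ, E) 𝓘(ℝ, Fin (2 * p) → ℝ) 1 f U ∧ S ∩ U = U ∩ f ⁻¹' {0} ∧
          Function.Surjective (mfderiv 𝓘(ℝ, E) 𝓘(ℝ, Fin (2 * p) → ℝ) f x) ∧
            ∀ v : TangentSpace 𝓘(ℝ, E) x, mfderiv 𝓘(ℝ, E) 𝓘(ℝ, Fin (2 * p) → ℝ) f x v = 0 →
              ∃ w : TangentSpace 𝓘(ℝ, E) x, mfderiv 𝓘(ℝ, E) 𝓘(ℝ, Fin (2 * p) → ℝ) f x w = 0 ∧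
                g.inner x (tangentJ E x v - w) (tangentJ E x v - w) ≤ t ^ 2 * g.inner x v v :=
  Iff.rfl

/-- Unfolding of `IsNearlyHolomorphicCycleSupport`, everything inlined (this is, up to the names
of the ambient manifold and metric, the text inlined by the items of route `HolomorphicityRate`).
[folklore] -/
theorem isNearlyHolomorphicCycleSupport_iff :
    IsNearlyHolomorphicCycleSupport g p t S Sg ↔
      IsClosed S ∧ IsClosed Sg ∧ Sg ⊆ S ∧ IsConnected (S \ Sg) ∧
        (∀ x ∈ Sg, IsAnalyticSetAt 𝓘(ℂ, E) S x) ∧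
        (∃ T : Set M, Sg ⊆ T ∧ (IsAnalyticSet 𝓘(ℂ, E) T ∧
          ∀ x ∈ regularLocus 𝓘(ℂ, E) T, ∀ q : ℕ,
            IsRegularPointOfCodim 𝓘(ℂ, E) T q x → p + 1 ≤ q)) ∧
        (∀ x ∈ S \ Sg, ∃ U : Set M, IsOpen U ∧ x ∈ U ∧ ∃ f : M → (Fin (2 * p) → ℝ),
          ContMDiffOn 𝓘(ℝ, E) 𝓘(ℝ, Fin (2 * p) → ℝ) 1 f U ∧ S ∩ U = U ∩ f ⁻¹' {0} ∧
            Function.Surjective (mfderiv 𝓘(ℝ, E) 𝓘(ℝ, Fin (2 * p) → ℝ) f x) ∧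
              ∀ v : TangentSpace 𝓘(ℝ, E) x, mfderiv 𝓘(ℝ, E) 𝓘(ℝ, Fin (2 * p) → ℝ) f x v = 0 →
                ∃ w : TangentSpace 𝓘(ℝ, E) x,
                  mfderiv 𝓘(ℝ, E) 𝓘(ℝ, Fin (2 * p) → ℝ) f x w = 0 ∧
                    g.inner x (tangentJ E x v - w) (tangentJ E x v - w) ≤
                      t ^ 2 * g.inner x v v) :=
  Iff.rfl

end Unfold

section UnfoldSmooth

variable [IsManifold 𝓘(ℝ, E) 1 M] {n : WithTop ℕ∞}

/-- **Bridge to the route's inline form.** For a `Cⁿ` Riemannian metric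
`g : Bundle.ContMDiffRiemannianMetric 𝓘(ℝ, E) n E (fun x : M ↦ TangentSpace 𝓘(ℝ, E) x)` (the
type quantified over by the items of route `HolomorphicityRate`, with `n = ∞`), the predicate for
the underlying metric `g.toRiemannianMetric` unfolds to the route's inline text verbatim
(`g.toRiemannianMetric.inner = g.inner` definitionally). [folklore] -/
theorem isNearlyHolomorphicCycleSupport_toRiemannianMetric_iff
    (g : ContMDiffRiemannianMetric 𝓘(ℝ, E) n E (fun x : M ↦ TangentSpace 𝓘(ℝ, E) x))
    {p : ℕ} {t : ℝ} {S Sg : Set M} :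
    IsNearlyHolomorphicCycleSupport g.toRiemannianMetric p t S Sg ↔
      (IsClosed S ∧ IsClosed Sg ∧ Sg ⊆ S ∧ IsConnected (S \ Sg) ∧
        (∀ x ∈ Sg, IsAnalyticSetAt 𝓘(ℂ, E) S x) ∧
        (∃ T : Set M, Sg ⊆ T ∧ (IsAnalyticSet 𝓘(ℂ, E) T ∧
          ∀ x ∈ regularLocus 𝓘(ℂ, E) T, ∀ q : ℕ,
            IsRegularPointOfCodim 𝓘(ℂ, E) T q x → p + 1 ≤ q)) ∧
        (∀ x ∈ S \ Sg, ∃ U : Set M, IsOpen U ∧ x ∈ U ∧ ∃ f : M → (Fin (2 * p) → ℝ),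
          ContMDiffOn 𝓘(ℝ, E) 𝓘(ℝ, Fin (2 * p) → ℝ) 1 f U ∧ S ∩ U = U ∩ f ⁻¹' {0} ∧
            Function.Surjective (mfderiv 𝓘(ℝ, E) 𝓘(ℝ, Fin (2 * p) → ℝ) f x) ∧
              ∀ v : TangentSpace 𝓘(ℝ, E) x, mfderiv 𝓘(ℝ, E) 𝓘(ℝ, Fin (2 * p) → ℝ) f x v = 0 →
                ∃ w : TangentSpace 𝓘(ℝ, E) x,
                  mfderiv 𝓘(ℝ, E) 𝓘(ℝ, Fin (2 * p) → ℝ) f x w = 0 ∧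
                    g.inner x (tangentJ E x v - w) (tangentJ E x v - w) ≤
                      t ^ 2 * g.inner x v v)) :=
  Iff.rfl

end UnfoldSmooth

/-! ### Elementary API -/

section Basic

variable {g g' : RiemannianMetric (fun x : M ↦ TangentSpace 𝓘(ℝ, E) x)} {p : ℕ} {t t' : ℝ}
  {S Sg : Set M} {x : M}

/-- `g_x(v, v) ≥ 0` for a Riemannian metric on the real tangent bundle (positive for `v ≠ 0`,
zero at `v = 0`). [folklore] -/
theorem riemannianMetric_inner_self_nonneg (g : RiemannianMetric (fun x : M ↦ TangentSpace 𝓘(ℝ, E) x))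
    (x : M) (v : TangentSpace 𝓘(ℝ, E) x) : 0 ≤ g.inner x v v := by
  by_cases hv : v = 0
  · subst hv
    simp
  · exact (g.pos x v hv).le

/-- `g_x(u, u) ≤ 0` forces `u = 0`. [folklore] -/
theorem riemannianMetric_eq_zero_of_inner_self_nonpos
    (g : RiemannianMetric (fun x : M ↦ TangentSpace 𝓘(ℝ, E) x)) (x : M)
    {u : TangentSpace 𝓘(ℝ, E) x} (hu : g.inner x u u ≤ 0) : u = 0 := by
  by_contra hne
  exact (g.pos x u hne).not_ge hu

/-- **Monotonicity in the defect** (pointwise): defect `≤ t` implies defect `≤ t'` whenever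
`|t| ≤ |t'|`. [folklore] -/
theorem HasJDefectLE.mono {V : Set (TangentSpace 𝓘(ℝ, E) x)} (h : HasJDefectLE g x t V)
    (htt' : |t| ≤ |t'|) : HasJDefectLE g x t' V := by
  intro v hv
  obtain ⟨w, hw, hle⟩ := h v hv
  exact ⟨w, hw, hle.trans (mul_le_mul_of_nonneg_right (sq_le_sq.2 htt')
    (riemannianMetric_inner_self_nonneg g x v))⟩

/-- Monotonicity in the defect for nearly holomorphic regular points. [folklore] -/
theorem IsNearlyHolomorphicRegularPoint.mono (h : IsNearlyHolomorphicRegularPoint g p t S x)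
    (htt' : |t| ≤ |t'|) : IsNearlyHolomorphicRegularPoint g p t' S x := by
  obtain ⟨U, hU, hxU, f, hf, hSU, hsurj, hV⟩ := h
  exact ⟨U, hU, hxU, f, hf, hSU, hsurj, hV.mono htt'⟩

/-- **Monotonicity in the defect**: a nearly holomorphic cycle support of defect `≤ t` has defect
`≤ t'` for every `t'` with `|t| ≤ |t'|` (item (a) of the definition request). [folklore] -/
theorem IsNearlyHolomorphicCycleSupport.mono (h : IsNearlyHolomorphicCycleSupport g p t S Sg)
    (htt' : |t| ≤ |t'|) : IsNearlyHolomorphicCycleSupport g p t' S Sg := by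
  obtain ⟨hS, hSg, hsub, hconn, han, hT, hreg⟩ := h
  exact ⟨hS, hSg, hsub, hconn, han, hT, fun x hx => (hreg x hx).mono htt'⟩

/-- Monotonicity for nonnegative defects `0 ≤ t ≤ t'`. [folklore] -/
theorem IsNearlyHolomorphicCycleSupport.mono_of_nonneg
    (h : IsNearlyHolomorphicCycleSupport g p t S Sg) (ht : 0 ≤ t) (htt' : t ≤ t') :
    IsNearlyHolomorphicCycleSupport g p t' S Sg :=
  h.mono (by rw [abs_of_nonneg ht, abs_of_nonneg (ht.trans htt')]; exact htt')

/-- **Defect `0` means `J`-stable**: `V` has defect `≤ 0` iff `J V ⊆ V` (for a real linear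
subspace: iff `V` is a complex subspace of `T_x M = E`). Uses positivity of `g`.
[cite: HanLi2005, §1] -/
theorem hasJDefectLE_zero_iff {V : Set (TangentSpace 𝓘(ℝ, E) x)} :
    HasJDefectLE g x 0 V ↔ ∀ v ∈ V, tangentJ E x v ∈ V := by
  refine ⟨fun h v hv => ?_, fun h v hv => ⟨tangentJ E x v, h v hv, ?_⟩⟩
  · obtain ⟨w, hw, hle⟩ := h v hv
    have h0 : g.inner x (tangentJ E x v - w) (tangentJ E x v - w) ≤ 0 := by simpa using hle
    have hvw : tangentJ E x v - w = 0 := riemannianMetric_eq_zero_of_inner_self_nonpos g x h0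
    rwa [sub_eq_zero.1 hvw]
  · simp

/-- A `J`-stable subset (e.g. the underlying real subspace of a complex subspace) has every
defect `t`. [folklore] -/
theorem HasJDefectLE.of_forall_tangentJ_mem {V : Set (TangentSpace 𝓘(ℝ, E) x)}
    (h : ∀ v ∈ V, tangentJ E x v ∈ V) (t : ℝ) : HasJDefectLE g x t V := by
  intro v hv
  refine ⟨tangentJ E x v, h v hv, ?_⟩
  simpa using mul_nonneg (sq_nonneg t) (riemannianMetric_inner_self_nonneg g x v)

/-- **Comparison of metrics** (pointwise): if `c₁ g_x ≤ g'_x ≤ c₂ g_x` on squares of vectors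
(`0 < c₁`, `0 ≤ c₂`), then defect `≤ t` for `g` implies defect `≤ t'` for `g'` as soon as
`c₂ t² ≤ c₁ t'²` (e.g. `t' = t √(c₂/c₁)`). This is the linear algebra behind "the defects for two
Riemannian metrics on a compact manifold are equivalent up to constants". [folklore] -/
theorem HasJDefectLE.of_inner_le {V : Set (TangentSpace 𝓘(ℝ, E) x)} {c₁ c₂ : ℝ}
    (h : HasJDefectLE g x t V) (hc₁ : 0 < c₁) (hc₂ : 0 ≤ c₂)
    (h₁ : ∀ u : TangentSpace 𝓘(ℝ, E) x, c₁ * g.inner x u u ≤ g'.inner x u u)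
    (h₂ : ∀ u : TangentSpace 𝓘(ℝ, E) x, g'.inner x u u ≤ c₂ * g.inner x u u)
    (ht : c₂ * t ^ 2 ≤ c₁ * t' ^ 2) : HasJDefectLE g' x t' V := by
  intro v hv
  obtain ⟨w, hw, hle⟩ := h v hv
  refine ⟨w, hw, le_of_mul_le_mul_left ?_ hc₁⟩
  have hgv := riemannianMetric_inner_self_nonneg g' x v
  calc c₁ * g'.inner x (tangentJ E x v - w) (tangentJ E x v - w)
      ≤ c₁ * (c₂ * (t ^ 2 * g.inner x v v)) :=
        mul_le_mul_of_nonneg_left ((h₂ _).trans (mul_le_mul_of_nonneg_left hle hc₂)) hc₁.le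
    _ = (c₂ * t ^ 2) * (c₁ * g.inner x v v) := by ring
    _ ≤ (c₂ * t ^ 2) * g'.inner x v v :=
        mul_le_mul_of_nonneg_left (h₁ v) (mul_nonneg hc₂ (sq_nonneg t))
    _ ≤ (c₁ * t' ^ 2) * g'.inner x v v := mul_le_mul_of_nonneg_right ht hgv
    _ = c₁ * (t' ^ 2 * g'.inner x v v) := by ring

/-- Comparison of metrics for nearly holomorphic regular points. [folklore] -/
theorem IsNearlyHolomorphicRegularPoint.of_inner_le {c₁ c₂ : ℝ}
    (h : IsNearlyHolomorphicRegularPoint g p t S x) (hc₁ : 0 < c₁) (hc₂ : 0 ≤ c₂)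
    (h₁ : ∀ u : TangentSpace 𝓘(ℝ, E) x, c₁ * g.inner x u u ≤ g'.inner x u u)
    (h₂ : ∀ u : TangentSpace 𝓘(ℝ, E) x, g'.inner x u u ≤ c₂ * g.inner x u u)
    (ht : c₂ * t ^ 2 ≤ c₁ * t' ^ 2) : IsNearlyHolomorphicRegularPoint g' p t' S x := by
  obtain ⟨U, hU, hxU, f, hf, hSU, hsurj, hV⟩ := h
  exact ⟨U, hU, hxU, f, hf, hSU, hsurj, hV.of_inner_le hc₁ hc₂ h₁ h₂ ht⟩

/-- **Comparison of metrics**: if `c₁ g ≤ g' ≤ c₂ g` pointwise on `M` (`0 < c₁`, `0 ≤ c₂`), a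
nearly holomorphic cycle support of defect `≤ t` for `g` is one of defect `≤ t'` for `g'` whenever
`c₂ t² ≤ c₁ t'²`; the sets `S`, `Sg` and all non-metric clauses are untouched (item (c) of the
definition request, pointwise-comparison half). [folklore] -/
theorem IsNearlyHolomorphicCycleSupport.of_inner_le {c₁ c₂ : ℝ}
    (h : IsNearlyHolomorphicCycleSupport g p t S Sg) (hc₁ : 0 < c₁) (hc₂ : 0 ≤ c₂)
    (h₁ : ∀ (x : M) (u : TangentSpace 𝓘(ℝ, E) x), c₁ * g.inner x u u ≤ g'.inner x u u)
    (h₂ : ∀ (x : M) (u : TangentSpace 𝓘(ℝ, E) x), g'.inner x u u ≤ c₂ * g.inner x u u)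
    (ht : c₂ * t ^ 2 ≤ c₁ * t' ^ 2) : IsNearlyHolomorphicCycleSupport g' p t' S Sg := by
  obtain ⟨hS, hSg, hsub, hconn, han, hT, hreg⟩ := h
  exact ⟨hS, hSg, hsub, hconn, han, hT,
    fun x hx => (hreg x hx).of_inner_le hc₁ hc₂ (h₁ x) (h₂ x) ht⟩

/-- `S` is closed. [folklore] -/
theorem IsNearlyHolomorphicCycleSupport.isClosed (h : IsNearlyHolomorphicCycleSupport g p t S Sg) :
    IsClosed S :=
  h.1

/-- The bad set `Sg` is closed. [folklore] -/
theorem IsNearlyHolomorphicCycleSupport.isClosed_bad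
    (h : IsNearlyHolomorphicCycleSupport g p t S Sg) : IsClosed Sg :=
  h.2.1

/-- `Sg ⊆ S`. [folklore] -/
theorem IsNearlyHolomorphicCycleSupport.subset (h : IsNearlyHolomorphicCycleSupport g p t S Sg) :
    Sg ⊆ S :=
  h.2.2.1

/-- The good part `S ∖ Sg` is connected (in particular nonempty). [folklore] -/
theorem IsNearlyHolomorphicCycleSupport.isConnected
    (h : IsNearlyHolomorphicCycleSupport g p t S Sg) : IsConnected (S \ Sg) :=
  h.2.2.2.1

/-- `S` is nonempty (its good part is connected). [folklore] -/
theorem IsNearlyHolomorphicCycleSupport.nonempty (h : IsNearlyHolomorphicCycleSupport g p t S Sg) :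
    S.Nonempty :=
  h.isConnected.nonempty.mono sdiff_subset

/-- `S` is analytic near each bad point. [folklore] -/
theorem IsNearlyHolomorphicCycleSupport.isAnalyticSetAt
    (h : IsNearlyHolomorphicCycleSupport g p t S Sg) (hx : x ∈ Sg) :
    IsAnalyticSetAt 𝓘(ℂ, E) S x :=
  h.2.2.2.2.1 x hx

/-- The bad set lies in a closed analytic set whose regular points have codimension `≥ p + 1`.
[folklore] -/
theorem IsNearlyHolomorphicCycleSupport.exists_isAnalyticSet
    (h : IsNearlyHolomorphicCycleSupport g p t S Sg) :
    ∃ T : Set M, Sg ⊆ T ∧ (IsAnalyticSet 𝓘(ℂ, E) T ∧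
      ∀ x ∈ regularLocus 𝓘(ℂ, E) T, ∀ q : ℕ, IsRegularPointOfCodim 𝓘(ℂ, E) T q x → p + 1 ≤ q) :=
  h.2.2.2.2.2.1

/-- Every good point is a nearly holomorphic regular point of codimension `p` and defect `≤ t`.
[folklore] -/
theorem IsNearlyHolomorphicCycleSupport.isNearlyHolomorphicRegularPoint
    (h : IsNearlyHolomorphicCycleSupport g p t S Sg) (hx : x ∈ S \ Sg) :
    IsNearlyHolomorphicRegularPoint g p t S x :=
  h.2.2.2.2.2.2 x hx

/-- **No bad set** (the case of Donaldson–Auroux zero loci): with `Sg = ∅` the predicate says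
exactly that `S` is closed, connected, and a nearly holomorphic regular point of itself of
codimension `p` and defect `≤ t` everywhere (the analytic clauses are witnessed by `T = ∅`).
[cite: McDuffSalamon2017, Thm. 7.4.1] -/
theorem isNearlyHolomorphicCycleSupport_empty_iff :
    IsNearlyHolomorphicCycleSupport g p t S ∅ ↔
      IsClosed S ∧ IsConnected S ∧ ∀ x ∈ S, IsNearlyHolomorphicRegularPoint g p t S x := by
  constructor
  · rintro ⟨hS, -, -, hconn, -, -, hreg⟩
    rw [Set.sdiff_empty] at hconn hreg
    exact ⟨hS, hconn, hreg⟩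
  · rintro ⟨hS, hconn, hreg⟩
    refine ⟨hS, isClosed_empty, empty_subset _, by rwa [Set.sdiff_empty], fun x hx => hx.elim,
      ⟨∅, empty_subset _, isAnalyticSet_empty, fun x hx => ?_⟩, by rwa [Set.sdiff_empty]⟩
    exact ((regularLocus_subset (I := 𝓘(ℂ, E)) (∅ : Set M)) hx).elim

end Basic

/-! ### Holomorphic equations give defect `0` -/

section Holomorphic

variable [FiniteDimensional ℂ E] [IsManifold 𝓘(ℂ, E) ω M] [IsManifold 𝓘(ℝ, E) ∞ M]

/-- The real dimension of `ℂᵖ` is that of `ℝ^{2p}`. [folklore] -/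
theorem finrank_real_fin_complex (p : ℕ) :
    Module.finrank ℝ (Fin p → ℂ) = Module.finrank ℝ (Fin (2 * p) → ℝ) := by
  rw [finrank_real_of_complex, Module.finrank_fin_fun, Module.finrank_fin_fun]

/-- **Regular points of complex codimension `p` are nearly holomorphic regular points of defect
`0`** (hence of every defect `t`), for every metric `g`: if `S ∩ U = U ∩ f⁻¹(0)` with
`f : M → ℂᵖ` holomorphic on `U` and `df_x` onto, compose `f` with a real-linear isomorphism
`ℂᵖ ≃ ℝ^{2p}`; the composite is real `C¹` (indeed `C^∞`, Osgood), has the same zero set and a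
surjective real differential, whose kernel `ker df_x` is `J`-stable because the real differential
of a holomorphic map is `ℂ`-linear
(`Literature.NumberTheory.Transcendental.mfderiv_real_eq_restrictScalars`).
[cite: VoisinHodgeI2002, §2.2.1] -/
theorem IsRegularPointOfCodim.isNearlyHolomorphicRegularPoint
    (g : RiemannianMetric (fun x : M ↦ TangentSpace 𝓘(ℝ, E) x)) {S : Set M} {p : ℕ} {x : M}
    (hx : IsRegularPointOfCodim 𝓘(ℂ, E) S p x) (t : ℝ) :
    IsNearlyHolomorphicRegularPoint g p t S x := by
  obtain ⟨U, hU, hxU, f, hf, hSU, hsurj⟩ := hx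
  let L : (Fin p → ℂ) ≃L[ℝ] (Fin (2 * p) → ℝ) :=
    ContinuousLinearEquiv.ofFinrankEq (finrank_real_fin_complex p)
  have hfx : MDifferentiableAt 𝓘(ℂ, E) 𝓘(ℂ, Fin p → ℂ) f x :=
    (hf x hxU).mdifferentiableAt (hU.mem_nhds hxU)
  -- the real differential of `L ∘ f` at `x`
  set D : E →L[ℂ] (Fin p → ℂ) := mfderiv 𝓘(ℂ, E) 𝓘(ℂ, Fin p → ℂ) f x with hD
  have hDf : HasMFDerivAt 𝓘(ℝ, E) 𝓘(ℝ, Fin p → ℂ) f x (D.restrictScalars ℝ) :=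
    Literature.NumberTheory.Transcendental.hasMFDerivAt_real_of_complex hfx.hasMFDerivAt
  have hL : HasMFDerivAt 𝓘(ℝ, Fin p → ℂ) 𝓘(ℝ, Fin (2 * p) → ℝ)
      (L : (Fin p → ℂ) → (Fin (2 * p) → ℝ)) (f x) (L : (Fin p → ℂ) →L[ℝ] (Fin (2 * p) → ℝ)) :=
    (L : (Fin p → ℂ) →L[ℝ] (Fin (2 * p) → ℝ)).hasMFDerivAt
  have hmf : mfderiv 𝓘(ℝ, E) 𝓘(ℝ, Fin (2 * p) → ℝ) ((L : (Fin p → ℂ) → (Fin (2 * p) → ℝ)) ∘ f) x =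
      (L : (Fin p → ℂ) →L[ℝ] (Fin (2 * p) → ℝ)).comp (D.restrictScalars ℝ) :=
    (hL.comp x hDf).mfderiv
  have happly : ∀ v : E,
      mfderiv 𝓘(ℝ, E) 𝓘(ℝ, Fin (2 * p) → ℝ) ((L : (Fin p → ℂ) → (Fin (2 * p) → ℝ)) ∘ f) x v =
        L (D v) := fun v => by
    rw [hmf]
    rfl
  refine ⟨U, hU, hxU, (L : (Fin p → ℂ) → (Fin (2 * p) → ℝ)) ∘ f, ?_, ?_, ?_, ?_⟩
  · -- real `C¹`
    exact (L : (Fin p → ℂ) →L[ℝ] (Fin (2 * p) → ℝ)).contMDiff.comp_contMDiffOn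
      ((contMDiffOn_real_of_mdifferentiableOn_complex hf hU).of_le (by exact_mod_cast le_top))
  · -- same zero set
    rw [hSU, Set.preimage_comp]
    congr 1
    ext y
    simp only [mem_preimage, mem_singleton_iff]
    exact (L.map_eq_zero_iff).symm
  · -- surjective real differential
    intro y
    obtain ⟨v, hv⟩ : ∃ v : E, D v = L.symm y := hsurj (L.symm y)
    exact ⟨v, (happly v).trans (by rw [hv, ContinuousLinearEquiv.apply_symm_apply])⟩
  · -- `J`-stable kernel, hence every defect
    refine HasJDefectLE.of_forall_tangentJ_mem (fun v hv => ?_) t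
    simp only [mem_setOf_eq] at hv ⊢
    rw [happly] at hv ⊢
    have hv' : D v = 0 := L.map_eq_zero_iff.1 hv
    rw [tangentJ_apply, D.map_smul, hv', smul_zero, map_zero]
    rfl

/-- On an analytic set of pure codimension `p`, every regular point is a nearly holomorphic
regular point of codimension `p` and defect `0` (hence `≤ t` for all `t`), for every metric.
[cite: Chirka1989, §2.3] -/
theorem HasPureCodim.isNearlyHolomorphicRegularPoint {S : Set M} {p : ℕ}
    (h : HasPureCodim 𝓘(ℂ, E) S p) (g : RiemannianMetric (fun x : M ↦ TangentSpace 𝓘(ℝ, E) x))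
    (t : ℝ) {x : M} (hx : x ∈ regularLocus 𝓘(ℂ, E) S) :
    IsNearlyHolomorphicRegularPoint g p t S x :=
  (h.2.2 x hx).isNearlyHolomorphicRegularPoint g t

/-- **Holomorphic chains are nearly holomorphic cycle supports of defect `0`.** An analytic
subset `S` of pure codimension `p` whose regular locus is connected (for analytic sets:
irreducibility, Chirka §5.3) and whose singular locus lies in a closed analytic set with regular
points of codimension `≥ p + 1` (Chirka §5.2 Thm. 2: `dim sng A < dim A`) is, for every metric
`g` and every `t`, a nearly holomorphic cycle support of codimension `p` and defect `≤ t` with bad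
set `Sg = sng S`. The two deep inputs are hypotheses here, not named facts.
[cite: Chirka1989, §2.3 and §5.2 Thm. 2] -/
theorem HasPureCodim.isNearlyHolomorphicCycleSupport {S : Set M} {p : ℕ}
    (h : HasPureCodim 𝓘(ℂ, E) S p) (hconn : IsConnected (regularLocus 𝓘(ℂ, E) S))
    (hT : ∃ T : Set M, singularLocus 𝓘(ℂ, E) S ⊆ T ∧ (IsAnalyticSet 𝓘(ℂ, E) T ∧
      ∀ x ∈ regularLocus 𝓘(ℂ, E) T, ∀ q : ℕ, IsRegularPointOfCodim 𝓘(ℂ, E) T q x → p + 1 ≤ q))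
    (g : RiemannianMetric (fun x : M ↦ TangentSpace 𝓘(ℝ, E) x)) (t : ℝ) :
    IsNearlyHolomorphicCycleSupport g p t S (singularLocus 𝓘(ℂ, E) S) := by
  have hreg : S \ singularLocus 𝓘(ℂ, E) S = regularLocus 𝓘(ℂ, E) S :=
    Set.sdiff_sdiff_cancel_left (regularLocus_subset S)
  refine ⟨h.1.isClosed, h.1.isClosed_singularLocus, singularLocus_subset S, by rwa [hreg],
    fun x _ => h.1 x, hT, fun x hx => ?_⟩
  rw [hreg] at hx
  exact h.isNearlyHolomorphicRegularPoint g t hx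

end Holomorphic

end Literature.Geometry.Kaehler
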